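import Summits.RiemannHypothesis.RiemannHypothesis.Theorems.DBNStripKernelFourier
import HarnessLib

/-!
# RiemannHypothesis / DBN — F1/F1′: two-boundary Poisson representation on the strip

RH-FREE harmonic analysis (THEORY-R4 §2 of the `pub-dbn` cell, `Sketch4.lean` sha16 3a8b9a024097398f;
support-grade).  The typed statements `ProbeStripRepresentation` (F1) and `DescentStripRepresentation`
(F1′), byte-verbatim `DbnTheory4.ProbeStripRepresentation` / `DbnTheory4.DescentStripRepresentation`, and
their proofs:

* F1′ `DescentStripRepresentation_holds`: for `|η| < 1`,
  `P(ξ,η) = 2π Q^{(η)}(ξ) + ∫ Q^{(η)}(ξ−s) · 4/(s²+4) ds` — the descent kernel is the strip-Poisson extension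
  of its boundary trace `2π·δ₀ + 4/(s²+4)`;
* F1 `ProbeStripRepresentation_holds`: for `c > 1`, `|η| < 1`,
  `S_{c,κ,u}(ξ,η) = ∫ Q^{(η)}(ξ−s) S_{c,κ,u}(s,1) ds` — the smeared probe kernel is the strip-Poisson extension
  of its boundary trace.

Proof (Fourier side, no contour integration): by `Theorems/DBNStripKernelFourier.lean`,
`Q^{(η)} = 𝓕⁻[m]`, `m(w) = cosh(2πηw)/cosh(2πw)`, and `cauchy_a ⋆ Q^{(η)} = 𝓕⁻[π e^{−2πa|w|} m]`;
the multiplier identity `(1+e^{−4π|w|}) m(w) = (e^{2πηw}+e^{−2πηw}) e^{−2π|w|}` turns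
`2π m + 𝓕[4/(s²+4)]·m` (F1′) and `𝓕[cauchy_{c−1}+cauchy_{c+1}]·m` (F1) into
`π(e^{2πηw}+e^{−2πηw})e^{−2πc|w|}` (`c = 1`, resp. the probe height `c`), whose inverse Fourier integral is
`(c−η)/(x²+(c−η)²) + (c+η)/(x²+(c+η)²)` (`Theorems/DBNCauchyFourier.lean`); for F1 the biweight smear and the
shift `u + κv` are carried through by Fubini on `ℝ × (-1,1]` and translation invariance.

`--supports stmt-RiemannHypothesis-0274`; support-grade, SHARPENS the reading of T1a/T13 (the probe class is the
cone of strip-Poisson extensions of its boundary data), LOWERS NOTHING; nothing here bears on the truth of RH.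
-/

noncomputable section

-- D-0017: `Summit.<S>.<S>.…` is the designed namespace of a single-problem summit.
set_option linter.dupNamespace false

open scoped Real FourierTransform Convolution
open MeasureTheory Set Filter Complex

namespace Summit.RiemannHypothesis.RiemannHypothesis.Theorems.DbnTheory
/-! ## F1′: the two-boundary Poisson representation of the descent kernel -/

/-- F1′ (RH-FREE).  Verbatim `DbnTheory4.DescentStripRepresentation`:
`P(·,η) = 2π·Q^{(η)} + Q^{(η)} ∗ 4/(·²+4)`. -/
def DescentStripRepresentation : Prop :=
  ∀ ξ η : ℝ, |η| < 1 →
    descentKernel ξ η = 2 * π * stripKernel η ξ + ∫ s, stripKernel η (ξ - s) * (4 / (s^2 + 4))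

/-- The real convolution in F1′ is twice `cauchy 2 ⋆ Q^{(η)}`. [folklore] -/
theorem integral_stripKernel_mul_four_div (η ξ : ℝ) :
    (((∫ s, stripKernel η (ξ - s) * (4 / (s^2 + 4))) : ℝ) : ℂ)
      = 2 * ((fun s : ℝ => ((cauchy 2 s : ℝ) : ℂ)) ⋆[ContinuousLinearMap.mul ℂ ℂ]
          (fun s : ℝ => ((stripKernel η s : ℝ) : ℂ))) ξ := by
  rw [convolution_def]
  simp only [ContinuousLinearMap.mul_apply']
  simp_rw [← Complex.ofReal_mul]
  rw [integral_complex_ofReal, ← Complex.ofReal_ofNat, ← Complex.ofReal_mul, ← MeasureTheory.integral_const_mul]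
  congr 1
  congr 1; funext s
  unfold cauchy
  norm_num
  ring

/-- **F1′** `DescentStripRepresentation` (THEORY-R4 §2): for `|η| < 1`,
`P(ξ,η) = 2π Q^{(η)}(ξ) + ∫ Q^{(η)}(ξ−s) · 4/(s²+4) ds`. [folklore] -/
theorem DescentStripRepresentation_holds : DescentStripRepresentation := by
  intro ξ η hη
  have h1 : |η| < (1 : ℝ) := hη
  apply Complex.ofReal_injective
  push_cast
  rw [show ((2 : ℂ) * (π : ℂ) * (stripKernel η ξ : ℂ)) = 2 * π * ((stripKernel η ξ : ℝ) : ℂ) by rfl,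
    stripKernel_eq_fourierInv hη ξ]
  rw [show (((∫ s, stripKernel η (ξ - s) * (4 / (s^2 + 4))) : ℝ) : ℂ) = _ from
    integral_stripKernel_mul_four_div η ξ,
    cauchy_conv_stripKernel_eq_fourierInv hη two_pos ξ]
  rw [Real.fourierInv_eq_fourier_neg, Real.fourierInv_eq_fourier_neg,
    Real.fourier_real_eq_integral_exp_smul, Real.fourier_real_eq_integral_exp_smul]
  simp_rw [smul_eq_mul]
  have hM := integrable_cexp_mul (integrable_stripMultiplierC hη) ξ
  have hEM : Integrable fun v : ℝ => Complex.exp (↑(-2 * π * v * -ξ) * I) *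
      (((π * Real.exp (-(2 * π * 2 * |v|)) : ℝ) : ℂ) * ((Real.cosh (2 * π * η * v) / Real.cosh (2 * π * v) : ℝ) : ℂ)) :=
    integrable_cexp_mul (integrable_expKernel_mul_stripMultiplierC hη (by norm_num : (0:ℝ) ≤ 2)) ξ
  rw [← MeasureTheory.integral_const_mul, ← MeasureTheory.integral_const_mul,
    ← integral_add (hM.const_mul _) (hEM.const_mul _)]
  -- pointwise: 2π·e·M + 2·e·(E₂·M) = 2 · e · π(e^{..}+e^{..})e^{-2π|v|}
  have hpt : ∀ v : ℝ, 2 * (π : ℂ) * (Complex.exp (↑(-2 * π * v * -ξ) * I) *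
        ((Real.cosh (2 * π * η * v) / Real.cosh (2 * π * v) : ℝ) : ℂ))
      + 2 * (Complex.exp (↑(-2 * π * v * -ξ) * I) *
        (((π * Real.exp (-(2 * π * 2 * |v|)) : ℝ) : ℂ) * ((Real.cosh (2 * π * η * v) / Real.cosh (2 * π * v) : ℝ) : ℂ)))
      = 2 * (Complex.exp (↑(-2 * π * v * -ξ) * I) *
        (((π * (Real.exp (2 * π * η * v) + Real.exp (-(2 * π * η * v))) * Real.exp (-(2 * π * 1 * |v|))) : ℝ) : ℂ)) := by
    intro v
    have hm := stripMultiplier_identity η v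
    have e4 : Real.exp (-(2 * π * 2 * |v|)) = Real.exp (-(4 * π * |v|)) := by congr 1; ring
    have e5 : Real.exp (-(2 * π * 1 * |v|)) = Real.exp (-(2 * π * |v|)) := by congr 1; ring
    rw [e4, e5]
    have : (π * (Real.exp (2 * π * η * v) + Real.exp (-(2 * π * η * v))) * Real.exp (-(2 * π * |v|)))
        = π * ((1 + Real.exp (-(4 * π * |v|))) * (Real.cosh (2 * π * η * v) / Real.cosh (2 * π * v))) := by
      rw [hm]; ring
    rw [this]
    push_cast
    ring
  simp_rw [hpt]
  rw [MeasureTheory.integral_const_mul, integral_cexp_mul_twoSided (by simpa using h1) ξ]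
  unfold descentKernel
  push_cast
  ring


/-! ## F1: the two-boundary Poisson representation of the probe kernel -/

/-- **Poisson smoothing of the strip kernel, summed over the two boundary heights**:
`((cauchy_{c−1} + cauchy_{c+1}) ⋆ Q^{(η)})(x) = cauchy_{c−η}(x) + cauchy_{c+η}(x)` (`c > 1`, `|η| < 1`). [folklore] -/
theorem cauchy_pair_conv_stripKernel {c η : ℝ} (hc : 1 < c) (hη : |η| < 1) (x : ℝ) :
    ∫ t : ℝ, (cauchy (c - 1) t + cauchy (c + 1) t) * stripKernel η (x - t)
      = cauchy (c - η) x + cauchy (c + η) x := by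
  have hc1 : 0 < c - 1 := by linarith
  have hc2 : 0 < c + 1 := by linarith
  have hηc : |η| < c := lt_trans hη hc
  have hQx : Integrable fun t : ℝ => stripKernel η (x - t) := (integrable_stripKernel hη).comp_sub_left x
  have hi : ∀ {a : ℝ}, 0 < a → Integrable fun t : ℝ => cauchy a t * stripKernel η (x - t) := by
    intro a ha
    refine hQx.bdd_mul (c := a⁻¹) (continuous_cauchy ha).aestronglyMeasurable
      (Eventually.of_forall fun t => ?_)
    rw [Real.norm_of_nonneg (cauchy_nonneg ha t)]
    exact cauchy_le_inv ha t
  -- complexify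
  apply Complex.ofReal_injective
  have hconv : ∀ {a : ℝ}, 0 < a → (((∫ t : ℝ, cauchy a t * stripKernel η (x - t)) : ℝ) : ℂ)
      = ((fun s : ℝ => ((cauchy a s : ℝ) : ℂ)) ⋆[ContinuousLinearMap.mul ℂ ℂ]
          (fun s : ℝ => ((stripKernel η s : ℝ) : ℂ))) x := by
    intro a ha
    rw [convolution_def]
    simp only [ContinuousLinearMap.mul_apply']
    simp_rw [← Complex.ofReal_mul]
    rw [integral_complex_ofReal]
  simp_rw [add_mul]
  rw [integral_add (hi hc1) (hi hc2)]
  push_cast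
  rw [hconv hc1, hconv hc2, cauchy_conv_stripKernel_eq_fourierInv hη hc1 x,
    cauchy_conv_stripKernel_eq_fourierInv hη hc2 x, Real.fourierInv_eq_fourier_neg,
    Real.fourierInv_eq_fourier_neg, Real.fourier_real_eq_integral_exp_smul,
    Real.fourier_real_eq_integral_exp_smul]
  simp_rw [smul_eq_mul]
  rw [← integral_add (integrable_cexp_mul (integrable_expKernel_mul_stripMultiplierC hη hc1.le) x)
    (integrable_cexp_mul (integrable_expKernel_mul_stripMultiplierC hη hc2.le) x)]
  have hpt : ∀ v : ℝ, Complex.exp (↑(-2 * π * v * -x) * I) *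
        (((π * Real.exp (-(2 * π * (c - 1) * |v|)) : ℝ) : ℂ) * ((Real.cosh (2 * π * η * v) / Real.cosh (2 * π * v) : ℝ) : ℂ))
      + Complex.exp (↑(-2 * π * v * -x) * I) *
        (((π * Real.exp (-(2 * π * (c + 1) * |v|)) : ℝ) : ℂ) * ((Real.cosh (2 * π * η * v) / Real.cosh (2 * π * v) : ℝ) : ℂ))
      = Complex.exp (↑(-2 * π * v * -x) * I) *
        (((π * (Real.exp (2 * π * η * v) + Real.exp (-(2 * π * η * v))) * Real.exp (-(2 * π * c * |v|))) : ℝ) : ℂ) := by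
    intro v
    have hm := stripMultiplier_identity η v
    have e1 : Real.exp (-(2 * π * (c - 1) * |v|)) = Real.exp (-(2 * π * c * |v|)) * Real.exp (2 * π * |v|) := by
      rw [← Real.exp_add]; congr 1; ring
    have e2 : Real.exp (-(2 * π * (c + 1) * |v|))
        = Real.exp (-(2 * π * c * |v|)) * Real.exp (2 * π * |v|) * Real.exp (-(4 * π * |v|)) := by
      rw [← Real.exp_add, ← Real.exp_add]; congr 1; ring
    have e3 : Real.exp (2 * π * |v|) * Real.exp (-(2 * π * |v|)) = 1 := by
      rw [← Real.exp_add]; simp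
    have key : (π * Real.exp (-(2 * π * (c - 1) * |v|))) * (Real.cosh (2 * π * η * v) / Real.cosh (2 * π * v))
        + (π * Real.exp (-(2 * π * (c + 1) * |v|))) * (Real.cosh (2 * π * η * v) / Real.cosh (2 * π * v))
        = π * (Real.exp (2 * π * η * v) + Real.exp (-(2 * π * η * v))) * Real.exp (-(2 * π * c * |v|)) := by
      rw [e1, e2]
      have : (π * (Real.exp (-(2 * π * c * |v|)) * Real.exp (2 * π * |v|))) *
            (Real.cosh (2 * π * η * v) / Real.cosh (2 * π * v))
          + (π * (Real.exp (-(2 * π * c * |v|)) * Real.exp (2 * π * |v|) * Real.exp (-(4 * π * |v|)))) *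
            (Real.cosh (2 * π * η * v) / Real.cosh (2 * π * v))
          = π * Real.exp (-(2 * π * c * |v|)) * Real.exp (2 * π * |v|) *
            ((1 + Real.exp (-(4 * π * |v|))) * (Real.cosh (2 * π * η * v) / Real.cosh (2 * π * v))) := by ring
      rw [this, hm]
      calc π * Real.exp (-(2 * π * c * |v|)) * Real.exp (2 * π * |v|) *
            ((Real.exp (2 * π * η * v) + Real.exp (-(2 * π * η * v))) * Real.exp (-(2 * π * |v|)))
          = π * (Real.exp (2 * π * η * v) + Real.exp (-(2 * π * η * v))) * Real.exp (-(2 * π * c * |v|)) *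
            (Real.exp (2 * π * |v|) * Real.exp (-(2 * π * |v|))) := by ring
        _ = _ := by rw [e3, mul_one]
    rw [← mul_add, ← Complex.ofReal_mul, ← Complex.ofReal_mul, ← Complex.ofReal_add, key]
  simp_rw [hpt]
  rw [integral_cexp_mul_twoSided hηc x]
  unfold cauchy
  push_cast
  ring

/-- Shifted form used inside the probe integral. [folklore] -/
theorem stripKernel_conv_cauchy_pair {c η : ℝ} (hc : 1 < c) (hη : |η| < 1) (ξ u κ v : ℝ) :
    ∫ s : ℝ, stripKernel η (ξ - s) * ((c - 1) / ((c - 1) ^ 2 + (s - u - κ * v) ^ 2)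
        + (c + 1) / ((c + 1) ^ 2 + (s - u - κ * v) ^ 2))
      = (c - η) / ((c - η) ^ 2 + (ξ - u - κ * v) ^ 2) + (c + η) / ((c + η) ^ 2 + (ξ - u - κ * v) ^ 2) := by
  have hsub := integral_add_right_eq_self (fun s : ℝ => stripKernel η (ξ - s) *
      ((c - 1) / ((c - 1) ^ 2 + (s - u - κ * v) ^ 2) + (c + 1) / ((c + 1) ^ 2 + (s - u - κ * v) ^ 2)))
    (μ := volume) (u + κ * v)
  rw [← hsub]
  have hpt : ∀ t : ℝ, (fun s : ℝ => stripKernel η (ξ - s) *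
      ((c - 1) / ((c - 1) ^ 2 + (s - u - κ * v) ^ 2) + (c + 1) / ((c + 1) ^ 2 + (s - u - κ * v) ^ 2))) (t + (u + κ * v))
      = (cauchy (c - 1) t + cauchy (c + 1) t) * stripKernel η ((ξ - u - κ * v) - t) := by
    intro t
    simp only [cauchy]
    rw [show t + (u + κ * v) - u - κ * v = t by ring, show ξ - (t + (u + κ * v)) = ξ - u - κ * v - t by ring]
    ring
  simp_rw [hpt]
  rw [cauchy_pair_conv_stripKernel hc hη]
  simp only [cauchy]
  ring

/-- F1 (RH-FREE, support-grade).  Verbatim `DbnTheory4.ProbeStripRepresentation`: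
`S(·,η) = Q^{(η)} ∗ S(·,1)` (`S` is bounded, harmonic on `|η| < c`, even in `η`). -/
def ProbeStripRepresentation : Prop :=
  ∀ c κ u ξ η : ℝ, 1 < c → |η| < 1 →
    probeKernel c κ u ξ η = ∫ s, stripKernel η (ξ - s) * probeKernel c κ u s 1

/-- Joint integrability of the F1 integrand on `ℝ × (-1,1]`. [folklore] -/
theorem integrable_stripKernel_probe_prod {c η : ℝ} (hc : 1 < c) (hη : |η| < 1) (κ u ξ : ℝ) :
    Integrable (fun p : ℝ × ℝ => stripKernel η (ξ - p.1) * (biweight p.2 *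
        ((c - 1) / ((c - 1) ^ 2 + (p.1 - u - κ * p.2) ^ 2) + (c + 1) / ((c + 1) ^ 2 + (p.1 - u - κ * p.2) ^ 2))))
      ((volume : Measure ℝ).prod (volume.restrict (Ioc (-1:ℝ) 1))) := by
  have hc1 : 0 < c - 1 := by linarith
  have hc2 : 0 < c + 1 := by linarith
  have hcont : Continuous (fun p : ℝ × ℝ => stripKernel η (ξ - p.1) * (biweight p.2 *
      ((c - 1) / ((c - 1) ^ 2 + (p.1 - u - κ * p.2) ^ 2) + (c + 1) / ((c + 1) ^ 2 + (p.1 - u - κ * p.2) ^ 2)))) := by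
    refine ((continuous_stripKernel hη).comp (by fun_prop)).mul
      ((continuous_biweight.comp continuous_snd).mul (Continuous.add ?_ ?_))
    · exact continuous_const.div (by fun_prop) (fun p => by positivity)
    · exact continuous_const.div (by fun_prop) (fun p => by positivity)
  -- domination by `Q(ξ - s) · (15/16)((c-1)⁻¹ + (c+1)⁻¹)`
  have hdom : Integrable (fun p : ℝ × ℝ => stripKernel η (ξ - p.1) * ((15/16 : ℝ) * ((c - 1)⁻¹ + (c + 1)⁻¹)))
      ((volume : Measure ℝ).prod (volume.restrict (Ioc (-1:ℝ) 1))) := by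
    have hQ' : Integrable (fun s : ℝ => stripKernel η (ξ - s)) (volume : Measure ℝ) :=
      (integrable_stripKernel hη).comp_sub_left ξ
    have hC : IntegrableOn (fun _ : ℝ => (15/16 : ℝ) * ((c - 1)⁻¹ + (c + 1)⁻¹)) (Ioc (-1:ℝ) 1) volume :=
      integrableOn_const (measure_Ioc_lt_top).ne
    exact hQ'.mul_prod hC
  refine hdom.mono' hcont.aestronglyMeasurable (Eventually.of_forall fun p => ?_)
  have hQ := stripKernel_nonneg hη (ξ - p.1)
  have hb0 := biweight_nonneg p.2
  have hb1 := biweight_le p.2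
  have hA0 : 0 ≤ (c - 1) / ((c - 1) ^ 2 + (p.1 - u - κ * p.2) ^ 2) := by positivity
  have hB0 : 0 ≤ (c + 1) / ((c + 1) ^ 2 + (p.1 - u - κ * p.2) ^ 2) := by positivity
  have hA : (c - 1) / ((c - 1) ^ 2 + (p.1 - u - κ * p.2) ^ 2) ≤ (c - 1)⁻¹ := by
    rw [div_le_iff₀ (by positivity), inv_mul_eq_div, le_div_iff₀ hc1]
    nlinarith [sq_nonneg (p.1 - u - κ * p.2)]
  have hB : (c + 1) / ((c + 1) ^ 2 + (p.1 - u - κ * p.2) ^ 2) ≤ (c + 1)⁻¹ := by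
    rw [div_le_iff₀ (by positivity), inv_mul_eq_div, le_div_iff₀ hc2]
    nlinarith [sq_nonneg (p.1 - u - κ * p.2)]
  rw [Real.norm_of_nonneg (by positivity)]
  have : biweight p.2 * ((c - 1) / ((c - 1) ^ 2 + (p.1 - u - κ * p.2) ^ 2)
      + (c + 1) / ((c + 1) ^ 2 + (p.1 - u - κ * p.2) ^ 2)) ≤ (15/16 : ℝ) * ((c - 1)⁻¹ + (c + 1)⁻¹) := by
    calc biweight p.2 * ((c - 1) / ((c - 1) ^ 2 + (p.1 - u - κ * p.2) ^ 2)
          + (c + 1) / ((c + 1) ^ 2 + (p.1 - u - κ * p.2) ^ 2))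
        ≤ (15/16 : ℝ) * ((c - 1) / ((c - 1) ^ 2 + (p.1 - u - κ * p.2) ^ 2)
          + (c + 1) / ((c + 1) ^ 2 + (p.1 - u - κ * p.2) ^ 2)) := by gcongr
      _ ≤ (15/16 : ℝ) * ((c - 1)⁻¹ + (c + 1)⁻¹) := by gcongr
  exact mul_le_mul_of_nonneg_left this hQ

/-- **F1** `ProbeStripRepresentation` (THEORY-R4 §2): for `c > 1`, `|η| < 1`,
`S_{c,κ,u}(ξ,η) = ∫ Q^{(η)}(ξ − s) S_{c,κ,u}(s,1) ds`. [folklore] -/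
theorem ProbeStripRepresentation_holds : ProbeStripRepresentation := by
  intro c κ u ξ η hc hη
  have hF := integrable_stripKernel_probe_prod hc hη κ u ξ
  symm
  calc ∫ s, stripKernel η (ξ - s) * probeKernel c κ u s 1
      = ∫ s, ∫ v in Ioc (-1:ℝ) 1, stripKernel η (ξ - s) * (biweight v *
          ((c - 1) / ((c - 1) ^ 2 + (s - u - κ * v) ^ 2) + (c + 1) / ((c + 1) ^ 2 + (s - u - κ * v) ^ 2))) := by
        congr 1; funext s
        rw [probeKernel_one, intervalIntegral.integral_of_le (by norm_num), ← integral_const_mul]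
    _ = ∫ v in Ioc (-1:ℝ) 1, ∫ s, stripKernel η (ξ - s) * (biweight v *
          ((c - 1) / ((c - 1) ^ 2 + (s - u - κ * v) ^ 2) + (c + 1) / ((c + 1) ^ 2 + (s - u - κ * v) ^ 2))) :=
        integral_integral_swap hF
    _ = ∫ v in Ioc (-1:ℝ) 1, biweight v *
          ((c - η) / ((c - η) ^ 2 + (ξ - u - κ * v) ^ 2) + (c + η) / ((c + η) ^ 2 + (ξ - u - κ * v) ^ 2)) := by
        congr 1; funext v
        have h := stripKernel_conv_cauchy_pair hc hη ξ u κ v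
        rw [← h, ← integral_const_mul]
        congr 1; funext s; ring
    _ = probeKernel c κ u ξ η := by
        unfold probeKernel
        rw [intervalIntegral.integral_of_le (by norm_num)]

end Summit.RiemannHypothesis.RiemannHypothesis.Theorems.DbnTheory

end
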